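import Summits.Ventures.PercRepro.Night2LocalRuleHybrid

/-!
# PercRepro — the distance-one shares of the hybrid rule, concretely (night-2, gen 24)

The share function that passed the nested-line geometries numerically (proofs/NIGHT-2-g24.md §8.4): the loss of a
`P`-pair `(B, z)` at its covering set `Q = B ∪ {z}` is split equally over the **distance-one targets**
`Q ∪ {y}`, `y ∈ G ∖ Q`, that are shadow sets, keep a positive residual capacity `cap2 > 0`, and lie outside the
common closure `facesClosure Q` of the thin covering preimages of `Q` (the requesting faces) — in the nested line:
the other points off the line, never a point of the line.

* `facesClosure M q G Q` — the points of `G` in the closure of every thin covering preimage of `Q`;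
* `dOneTargets M q G B z` — the distance-one targets of `(B, z)`; `dshOne` — the equal split of the loss;
* `dshOne_nonneg`, `dshOne_supp`, `dshOne_row` (the shares sum to the loss when a target exists);
* **`localShadowHall_of_distanceOne`**: `localShadowHall_of_hybrid` with `dsh := dshOne`: (LI_G) from (i) every
  lossy `P`-pair has a distance-one target, (ii) `dload S ≤ cap2 S` at every shadow set, (iii) the fair-share
  inequality of the non-`P` losses with the capacities `cap3`.
* `pi2MassH_false`, `cap3_false`: with `P := fun _ => False` the hybrid rule is rule L2F.
-/

namespace PercRepro.Shadow

open Finset PerFlat ThmH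

variable {α : Type*} [DecidableEq α] {M : Matroid α} [M.Finite]

section DistanceOne

variable (M) (q : ℕ) (G : Finset α)

open scoped Classical in
/-- The points of `G` in the closure of every thin covering preimage of `Q`. -/
noncomputable def facesClosure (Q : Finset α) : Finset α :=
  G.filter (fun y => ∀ B ∈ (coverPreimages M (Uq M (q + 2) q) G Q).filter (fun B => B ∉ lay0 M q G), y ∈ clF M B)

open scoped Classical in
/-- The distance-one targets of the pair `(B, z)`: the shadow sets `B ∪ {z, y}` with `y ∉ facesClosure (B ∪ {z})`
and `cap2 > 0`. -/
noncomputable def dOneTargets (B : Finset α) (z : α) : Finset (Finset α) :=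
  ((G \ insert z B).filter (fun y => y ∉ facesClosure M q G (insert z B) ∧
      insert y (insert z B) ∈ shadowAt M (q + 2) q (Uq M (q + 2) q) G ∧
      0 < cap2 M q G (insert y (insert z B)))).image (fun y => insert y (insert z B))

open scoped Classical in
/-- The equal split of the loss of `(B, z)` over its distance-one targets. -/
noncomputable def dshOne (B : Finset α) (z : α) (S : Finset α) : ℚ :=
  if S ∈ dOneTargets M q G B z then loss M q G B z / ((dOneTargets M q G B z).card : ℚ) else 0

end DistanceOne

section DistanceOneLemmas

variable {q : ℕ} {G : Finset α}

open scoped Classical in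
/-- Membership in `dOneTargets`. -/
theorem mem_dOneTargets {B S : Finset α} {z : α} :
    S ∈ dOneTargets M q G B z ↔ ∃ y ∈ G \ insert z B, y ∉ facesClosure M q G (insert z B) ∧
      insert y (insert z B) ∈ shadowAt M (q + 2) q (Uq M (q + 2) q) G ∧
      0 < cap2 M q G (insert y (insert z B)) ∧ insert y (insert z B) = S := by
  unfold dOneTargets
  rw [Finset.mem_image]
  constructor
  · rintro ⟨y, hy, rfl⟩
    rw [Finset.mem_filter] at hy
    exact ⟨y, hy.1, hy.2.1, hy.2.2.1, hy.2.2.2, rfl⟩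
  · rintro ⟨y, hy, h1, h2, h3, rfl⟩
    exact ⟨y, Finset.mem_filter.2 ⟨hy, h1, h2, h3⟩, rfl⟩

open scoped Classical in
/-- The distance-one targets are shadow sets. -/
theorem dOneTargets_subset_shadowAt (B : Finset α) (z : α) :
    dOneTargets M q G B z ⊆ shadowAt M (q + 2) q (Uq M (q + 2) q) G := by
  intro S hS
  obtain ⟨y, -, -, h2, -, rfl⟩ := mem_dOneTargets.1 hS
  exact h2

/-- The distance-one shares are nonnegative. -/
theorem dshOne_nonneg (hG : G ∈ flatsQ M (q + 1)) (hd : (gr M \ G).card ≤ q) (B : Finset α) (z : α)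
    (S : Finset α) : 0 ≤ dshOne M q G B z S := by
  unfold dshOne
  split_ifs
  · exact div_nonneg (loss_nonneg' hG hd B z) (by positivity)
  · exact le_refl _

/-- The distance-one shares are supported on the supersets of `B ∪ {z}`. -/
theorem dshOne_supp (B : Finset α) (z : α) (S : Finset α) (h : dshOne M q G B z S ≠ 0) : insert z B ⊆ S := by
  unfold dshOne at h
  split_ifs at h with hS
  · obtain ⟨y, -, -, -, -, rfl⟩ := mem_dOneTargets.1 hS
    exact Finset.subset_insert y _
  · exact absurd rfl h

open scoped Classical in
/-- The distance-one shares sum to the loss when a target exists (or the loss is zero). -/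
theorem dshOne_row (B : Finset α) (z : α)
    (hne : loss M q G B z ≠ 0 → (dOneTargets M q G B z).Nonempty) :
    ∑ S ∈ shadowAt M (q + 2) q (Uq M (q + 2) q) G, dshOne M q G B z S = loss M q G B z := by
  unfold dshOne
  rw [← Finset.sum_filter, Finset.filter_mem_eq_inter,
    Finset.inter_eq_right.2 (dOneTargets_subset_shadowAt B z), Finset.sum_const, nsmul_eq_mul]
  by_cases hl : loss M q G B z = 0
  · rw [hl]; ring
  · have hpos : (0 : ℚ) < ((dOneTargets M q G B z).card : ℚ) := by
      exact_mod_cast Finset.card_pos.2 (hne hl)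
    field_simp

open scoped Classical in
/-- **The local form from the hybrid rule with the distance-one shares**: (LI_G) follows from (i) every lossy
`P`-pair has a distance-one target, (ii) the distance-one loads stay within `cap2`, (iii) the per-loss inequality of the
non-`P` pairs with the capacities `cap3`. -/
theorem localShadowHall_of_distanceOne {P : Finset α → Prop} [DecidablePred P] (hG : G ∈ flatsQ M (q + 1))
    (hd : (gr M \ G).card ≤ q)
    (hne : ∀ B ∈ thinMembers M q G, P B → ∀ z ∈ G \ clF M B, loss M q G B z ≠ 0 →
      (dOneTargets M q G B z).Nonempty)
    (hdl : ∀ S ∈ shadowAt M (q + 2) q (Uq M (q + 2) q) G, dload M q G P (dshOne M q G) S ≤ cap2 M q G S)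
    (hcond : ∀ B ∈ thinMembers M q G, ¬ P B → ∀ z ∈ G \ clF M B,
      loss M q G B z ≤ rhoL M q G B z * lossIncomeH M q G P (dshOne M q G) B z) :
    LocalShadowHall M q G :=
  localShadowHall_of_hybrid hG hd (dshOne_nonneg hG hd) (dshOne_supp)
    (fun B hB hP z hz => dshOne_row B z (hne B hB hP z hz)) hdl hcond

/-! ## `P := False` is rule L2F -/

open scoped Classical in
/-- With `P := False` the non-`P` mass is the mass of rule L2F. -/
theorem pi2MassH_false (S : Finset α) : pi2MassH M q G (fun _ => False) S = pi2Mass M q G S := by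
  unfold pi2MassH pi2Mass
  rw [Finset.filter_true_of_mem (fun _ _ => not_false)]

open scoped Classical in
/-- With `P := False` there is no distance-one load. -/
theorem dload_false (dsh : Finset α → α → Finset α → ℚ) (S : Finset α) :
    dload M q G (fun _ => False) dsh S = 0 := by
  unfold dload
  rw [Finset.filter_false_of_mem (fun _ _ => not_false), Finset.sum_empty]

/-- With `P := False` the capacity `cap3` is `cap2`. -/
theorem cap3_false (dsh : Finset α → α → Finset α → ℚ) (S : Finset α) :
    cap3 M q G (fun _ => False) dsh S = cap2 M q G S := by
  unfold cap3; rw [dload_false, sub_zero]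

/-- With `P := False` the income is the income of rule L2F. -/
theorem lossIncomeH_false (dsh : Finset α → α → Finset α → ℚ) (B : Finset α) (z : α) :
    lossIncomeH M q G (fun _ => False) dsh B z = lossIncome M q G B z := by
  unfold lossIncomeH lossIncome
  apply Finset.sum_congr rfl
  intro S _
  rw [cap3_false, pi2MassH_false]

end DistanceOneLemmas

end PercRepro.Shadow
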